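import Mathlib.Probability.CondVar
import Mathlib.Probability.Moments.Covariance
import Literature.Probability.Independence.BlackNoiseCriterion
import HarnessLib

/-!
# The law of total covariance

For square-integrable real random variables `X, Y` on a probability space and a sub-σ-algebra `m`,

  `Cov(X, Y) = E[(X − E[X|m]) (Y − E[Y|m])] + Cov(E[X|m], E[Y|m])`,

i.e. covariance = mean conditional covariance + covariance of the conditional means (the polar form
of the law of total variance `integral_condVar_add_variance_condExp` of Mathlib; Durrett,
*Probability: Theory and Examples*, 5th ed., Ex. 4.1.7 and §4.1; Williams, *Probability with
Martingales*, §9.7). The first term is written as a plain integral of the product of the two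
residuals, which equals `E[ E[(X − E[X|m])(Y − E[Y|m]) | m] ]` by `integral_condExp`.

Use in the tree: the "law of total covariance over the flat-background sector" step (B5) of the
blueprint of crux `FemtoCurvatureTwoPoint` (route `LangevinControlUV`, line
`generic-step-gamma-encoding`): on the axis the second term is a non-negative variance.

## Main results

* `integral_residual_mul_residual` — `∫ (X − E[X|m])(Y − E[Y|m]) = ∫ X Y − ∫ E[X|m] E[Y|m]`.
* `integral_residual_mul_add_covariance_condExp` — the law of total covariance.

Mathlib has the variance case only (`integral_condVar_add_variance_condExp`; searched `condVar`,
`covariance_condExp`, `total covariance`). The tree's companion file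
`TotalCovarianceCondExp.lean` (same namespace) has the LOWER-BOUND form
`total_covariance_lower_bound_condExp` for bounded variables with nearly constant conditional
means; the present file is the exact `L²` identity in Mathlib's `cov[·, ·; μ]` vocabulary. The
pull-out step `∫ X · E[Y|m] = ∫ E[X|m] · E[Y|m]` is REUSED from
`Literature.Probability.Independence.integral_mul_condExp_eq` / `integral_condExp_mul_eq`
(`BlackNoiseCriterion.lean`).
-/

noncomputable section

open MeasureTheory ProbabilityTheory

namespace Literature.Probability.Moments

variable {Ω : Type*} {m m₀ : MeasurableSpace Ω} {μ : Measure[m₀] Ω} {X Y : Ω → ℝ}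

/-- **The mean conditional covariance, expanded**: for `X, Y ∈ L²`,
`∫ (X − E[X|m])(Y − E[Y|m]) dμ = ∫ X Y dμ − ∫ E[X|m] E[Y|m] dμ`. [folklore] -/
theorem integral_residual_mul_residual (hm : m ≤ m₀) [IsFiniteMeasure μ] (hX : MemLp X 2 μ)
    (hY : MemLp Y 2 μ) :
    ∫ ω, (X ω - (μ[X | m]) ω) * (Y ω - (μ[Y | m]) ω) ∂μ =
      ∫ ω, X ω * Y ω ∂μ - ∫ ω, (μ[X | m]) ω * (μ[Y | m]) ω ∂μ := by
  have hYc : MemLp (μ[Y | m]) 2 μ := hY.condExp one_le_two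
  have hXc : MemLp (μ[X | m]) 2 μ := hX.condExp one_le_two
  have i1 : Integrable (fun ω => X ω * Y ω) μ := memLp_one_iff_integrable.1 (hY.mul' hX)
  have i2 : Integrable (fun ω => X ω * (μ[Y | m]) ω) μ := memLp_one_iff_integrable.1 (hYc.mul' hX)
  have i3 : Integrable (fun ω => (μ[X | m]) ω * Y ω) μ := memLp_one_iff_integrable.1 (hY.mul' hXc)
  have i4 : Integrable (fun ω => (μ[X | m]) ω * (μ[Y | m]) ω) μ :=
    memLp_one_iff_integrable.1 (hYc.mul' hXc)
  have hexp : ∀ ω, (X ω - (μ[X | m]) ω) * (Y ω - (μ[Y | m]) ω) =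
      X ω * Y ω - X ω * (μ[Y | m]) ω - ((μ[X | m]) ω * Y ω - (μ[X | m]) ω * (μ[Y | m]) ω) := by
    intro ω; ring
  have i12 : Integrable (fun ω => X ω * Y ω - X ω * (μ[Y | m]) ω) μ := i1.sub i2
  have i34 : Integrable (fun ω => (μ[X | m]) ω * Y ω - (μ[X | m]) ω * (μ[Y | m]) ω) μ := i3.sub i4
  simp_rw [hexp]
  -- the two pull-outs `∫ X E[Y|m] = ∫ E[X|m] E[Y|m] = ∫ E[X|m] Y` (self-adjointness on `L²`)
  rw [integral_sub i12 i34, integral_sub i1 i2, integral_sub i3 i4,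
    Literature.Probability.Independence.integral_mul_condExp_eq hm hX hY,
    Literature.Probability.Independence.integral_condExp_mul_eq hm hX hY]
  ring

/-- **Law of total covariance.** On a probability space, for `X, Y ∈ L²` and a sub-σ-algebra
`m ≤ m₀`: `∫ (X − E[X|m])(Y − E[Y|m]) dμ + Cov(E[X|m], E[Y|m]) = Cov(X, Y)` — mean conditional
covariance plus covariance of the conditional means (Durrett, Ex. 4.1.7 / §4.1 for the variance
form; Mathlib `integral_condVar_add_variance_condExp`). [folklore] -/
theorem integral_residual_mul_add_covariance_condExp (hm : m ≤ m₀) [IsProbabilityMeasure μ]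
    (hX : MemLp X 2 μ) (hY : MemLp Y 2 μ) :
    ∫ ω, (X ω - (μ[X | m]) ω) * (Y ω - (μ[Y | m]) ω) ∂μ + cov[μ[X | m], μ[Y | m]; μ] =
      cov[X, Y; μ] := by
  have hYc : MemLp (μ[Y | m]) 2 μ := hY.condExp one_le_two
  have hXc : MemLp (μ[X | m]) 2 μ := hX.condExp one_le_two
  rw [integral_residual_mul_residual hm hX hY, covariance_eq_sub hXc hYc, covariance_eq_sub hX hY,
    integral_condExp hm, integral_condExp hm]
  simp only [Pi.mul_apply]
  ring

end Literature.Probability.Moments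

end
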